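import Literature.Analysis.FluidPDE.DeRosaStages
import Literature.Analysis.FluidPDE.DeRosaStep
import Literature.Analysis.FluidPDE.DeRosaSchemeProofs
import Literature.Analysis.FluidPDE.DeRosaMollificationProofs
import Literature.Analysis.FluidPDE.OnsagerBDSVStagesProofs
import HarnessLib

/-!
# De Rosa's convex-integration scheme: the three stages imply the inductive proposition
# (Prop. 4.1) along histories, hence Prop. 4.1 run from zero (regime `γ < β`)

L. De Rosa, *Infinitely many Leray–Hopf solutions for the fractional Navier–Stokes equations*,
Comm. PDE 44 (2019) 335–365 = arXiv:1801.10235. Analysis/FluidPDE proofs file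
(definition-free). It PROVES, from the three stage facts `DeRosa.mollificationStage` (Prop. 5.1),
`DeRosa.gluingStage` (§5.2) and `DeRosa.perturbationStage` (§§5.3–5.5) of `DeRosaThreeStages.lean`
(combined into the seven stage estimates by `DeRosa.stageEstimates_of_threeStages`,
`DeRosaStages.lean`),

* `DeRosa.stepAt_of_threeStages : mollificationStage → gluingStage → perturbationStage →
    ∃ M > 0, ∀ β γ b …, DeRosa.StepAt M β γ α a b ν T`
  — De Rosa's main iterative proposition Prop. 4.1, one step along a construction history
  (`DeRosa.StepAt`, `DeRosaStep.lean`), under its printed quantifier prefix, in the regime `γ < β`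
  covered by its printed proof. (Under D-0026 neither this one-step statement — for a while the
  named fact `DeRosa.inductiveStepLT` — nor the seven stage estimates below it — for a while the
  named fact `DeRosa.stagesEstimate` — is kept as a named fact: both are interior nodes between
  the three stage facts and `DeRosa.iterativeSchemeLT`, with all reductions proved.)
* `DeRosa.iterativeSchemeLT_of_threeStages : mollificationStage → gluingStage →
    perturbationStage → DeRosa.iterativeSchemeLT` (Prop. 4.1 run from zero, the form §4.2
  consumes), by the iteration along histories `DeRosa.schemeAt_of_stepAt` of `DeRosaStep.lean`
  under the common prefix;
* `DeRosa.iterativeSchemeLT_of_gluing_of_perturbation : gluingStage → perturbationStage →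
    DeRosa.iterativeSchemeLT`, the same with the mollification stage discharged
  (`DeRosa.mollificationStage_holds`, `DeRosaMollificationProofs.lean`): the trust base of
  `DeRosa.iterativeSchemeLT` — hence of De Rosa's Thm. 2.1 and Thm. 1.2 in the tree — is the
  gluing and perturbation stages,

i.e. the last half page of the proof of the main iterative proposition (Prop. 4.1) — "Then
Proposition 4.1 is just a consequence of estimates (5.19)–(5.21), Proposition 5.1 and
Proposition 5.5 (again, a detailed proof can be found in [BDLSV2017])" (§5.3, p. 14 of the arXiv
text), which is the "Proof of Proposition 2.1" of Buckmaster–De Lellis–Székelyhidi–Vicol, §2.6 —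
together with the one ingredient the fractional scheme adds to it: the derivation, ALONG A
CONSTRUCTION HISTORY from zero, of the uniform spatial Hölder bound on the input velocity that
the stages consume (§4.2: "`∑_q ‖v_{q+1} - v_q‖_{β'} ≲ ∑ λ_q^{β'-β}` … hence `v_q` is uniformly
bounded in `C⁰_t C^{β'}_x`"; used on p. 14 in the proof of (5.18) as "`‖v_q‖_γ ≤ 1` for every
`γ < β`" and on p. 15 in the proof of Lemma 5.9).

## The argument, as formalised

`DeRosa.stageEstimates_of_threeStages` (`DeRosaStages.lean`) provides from the three stages, for
the parameters of Prop. 4.1 with `γ < β`, an exponent `θ ∈ (γ, β)` and a Hölder constant `C_H`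
fixed before the implicit constant `C` and the threshold `a₀`, from a stage-`q` triple with
(4.7)–(4.10) and `[v_q(t)]_θ ≤ C_H` the fields `v_ℓ`, `v̄_q`, `(v_{q+1}, p_{q+1}, R̊_{q+1})` with
the seven estimates (5.5), (5.6)|₀, (5.13)|₀, (5.15)|₀, (5.19), (5.20), (5.21) and
`v_{q+1}(·,0) = Ψ (e 0) (v_q(·,0))`. To get `DeRosa.StepAt` (one step along a history,
`DeRosaStep.lean`):

1. *Exponent and Hölder constant.* Take `θ = (γ+β)/2`. Along a history
   `(v_j)_{j ≤ q}` from `v₀ = 0` with (4.12) for `j < q`, interpolation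
   (`DeRosa.norm_increment_sub_le`: `[v_{j+1} - v_j]_θ ≤ (2M)^{1-θ}(6M)^θ λ_{j+1}^{θ-β}`) and
   summation give `[v_q(t)]_θ ≤ ∑_{k<q} (2M)^{1-θ}(6M)^θ λ_{k+1}^{-(β-θ)}`
   (`IsHistory.norm_sub_le_holderSum`), and this sum is bounded by a constant `H` uniformly in
   `q` and in `a ≥ 2` (`DeRosa.exists_holderSum_le`, comparison with a geometric series). So
   `C_H := H` can be fixed before `C` and `a₀`, as the quantifier order of the stage estimates
   demands, and the final threshold is `max(a₀, a₁, 2)`.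
2. *The BDSV half page*, verbatim from `BDSV.mainIteration_of_stagesEstimate`
   (`OnsagerBDSVStagesProofs.lean`): (4.12) and (4.8), (4.9) at `q+1` by the triangle inequality,
   (4.7) and (4.10) at `q+1` from (5.20), (5.21) through the parameter inequalities
   `BDSV.exists_mainThreshold` (valid for `α < -E₀/(8b)`, `E₀ = (2βb-(1-β))(b-1) < 0` by (4.11),
   and `a` large).
3. The time-zero clause `v_{q+1}(·,0) = Ψ_q (e 0) (v_q(·,0))` is passed through unchanged, and
   `StepAt → SchemeAt` (one step along every history ⇒ the scheme run from zero, by dependent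
   choice) is `DeRosa.schemeAt_of_stepAt`, threaded under the common quantifier prefix.

## References

* L. De Rosa, Comm. PDE 44 (2019), 335–365 = arXiv:1801.10235: §4.1 Prop. 4.1, (4.7)–(4.12);
  §4.2 (the uniform `C^{β'}` bound along the iteration); §5.3, p. 14 ("Then Proposition 4.1 is
  just a consequence of …"). [`Derosa2018`]
* T. Buckmaster, C. De Lellis, L. Székelyhidi Jr., V. Vicol, CPAM 72 (2019) = arXiv:1701.08678,
  §2.6 "Proof of Proposition 2.1", (2.25)–(2.26). [`BuckmasterEtAl2018`]
-/

open MeasureTheory Set Filter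
open scoped NNReal ENNReal ContDiff

noncomputable section

namespace Literature.Analysis.FluidPDE

namespace DeRosa

/-! ## The Hölder bound along a construction history -/

section History

variable {M β γ α a b ν T : ℝ} {e : ℝ → ℝ} {q : ℕ}
  {v : ℕ → ℝ → UnitAddTorus (Fin 3) → EuclideanSpace ℝ (Fin 3)}
  {p : ℕ → ℝ → UnitAddTorus (Fin 3) → ℝ}
  {R : ℕ → ℝ → UnitAddTorus (Fin 3) → Fin 3 → EuclideanSpace ℝ (Fin 3)}

/-- **Hölder bounds along a construction history** (De Rosa 2019, §4.2: summing the
interpolated increment bounds `‖v_{j+1} - v_j‖_{β'} ≲ λ_j^{β'-β}` from `v₀ = 0`, "hence `v_q` is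
uniformly bounded in `C⁰_t C^{β'}_x`"; the `IsHistory` twin of `DeRosa.norm_sub_le_holderSum`):
for a history up to stage `q`, every `j ≤ q`, `θ ∈ [0,1]` and `t ∈ [0,T]`,
`‖v_j(t,x) - v_j(t,y)‖ ≤ (∑_{k<j} (2M)^{1-θ}(6M)^θ λ_{k+1}^{-(β-θ)}) dist(x,y)^θ`.
[cite: Derosa2018, §4.2] -/
theorem IsHistory.norm_sub_le_holderSum (hH : IsHistory M β γ α a b ν T e q v p R) (hT : 0 ≤ T)
    (ha : 1 ≤ a) (hM : 0 ≤ M) {θ : ℝ} (hθ0 : 0 ≤ θ) (hθ1 : θ ≤ 1) {j : ℕ} (hj : j ≤ q) {t : ℝ}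
    (ht : t ∈ Icc 0 T) (x y : UnitAddTorus (Fin 3)) :
    ‖v j t x - v j t y‖ ≤
      (∑ k ∈ Finset.range j, ((2 * M) ^ (1 - θ) * (6 * M) ^ θ) *
          BDSV.freq a b (k + 1) ^ (-(β - θ))) * dist x y ^ θ := by
  induction j with
  | zero =>
      simp [hH.velocity_zero]
  | succ j ih =>
      have hjq : j < q := Nat.lt_of_succ_le hj
      have hw := norm_increment_sub_le (hH.isFracNSReynoldsOn j hjq.le)
        (hH.isFracNSReynoldsOn (j + 1) hj) (hH.velocityIncrementBound j hjq) hT ha hM hθ0 hθ1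
        ht x y
      rw [show (θ - β) = -(β - θ) by ring] at hw
      calc ‖v (j + 1) t x - v (j + 1) t y‖
          = ‖(v j t x - v j t y) + ((v (j + 1) t x - v j t x) - (v (j + 1) t y - v j t y))‖ := by
            congr 1; abel
        _ ≤ ‖v j t x - v j t y‖ + ‖(v (j + 1) t x - v j t x) - (v (j + 1) t y - v j t y)‖ :=
            norm_add_le _ _
        _ ≤ (∑ k ∈ Finset.range j, ((2 * M) ^ (1 - θ) * (6 * M) ^ θ) *
                BDSV.freq a b (k + 1) ^ (-(β - θ))) * dist x y ^ θ +
              ((2 * M) ^ (1 - θ) * (6 * M) ^ θ * BDSV.freq a b (j + 1) ^ (-(β - θ))) *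
                dist x y ^ θ :=
            add_le_add (ih hjq.le) hw
        _ = (∑ k ∈ Finset.range (j + 1), ((2 * M) ^ (1 - θ) * (6 * M) ^ θ) *
              BDSV.freq a b (k + 1) ^ (-(β - θ))) * dist x y ^ θ := by
            rw [Finset.sum_range_succ]; ring

/-- **The uniform Hölder bound of the last stage of a history** (De Rosa 2019, §4.2, in the form
consumed by the gluing and perturbation stages): if `H` bounds the Hölder sums
`∑_{k<j} (2M)^{1-θ}(6M)^θ λ_{k+1}^{-(β-θ)}`, then every slice `v_j(t)`, `j ≤ q`, `t ∈ [0,T]`, of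
a history up to stage `q` is `θ`-Hölder with constant `H` (`HolderWith`, quotient metric of `𝕋³`).
[cite: Derosa2018, §4.2] -/
theorem IsHistory.holderWith (hH : IsHistory M β γ α a b ν T e q v p R) (hT : 0 ≤ T)
    (ha : 1 ≤ a) (hM : 0 ≤ M) {θ : ℝ≥0} (hθ1 : (θ : ℝ) ≤ 1) {H : ℝ} (hH0 : 0 ≤ H)
    (hsum : ∀ j : ℕ, ∑ k ∈ Finset.range j, ((2 * M) ^ (1 - (θ : ℝ)) * (6 * M) ^ (θ : ℝ)) *
      BDSV.freq a b (k + 1) ^ (-(β - θ)) ≤ H)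
    {j : ℕ} (hj : j ≤ q) {t : ℝ} (ht : t ∈ Icc 0 T) :
    HolderWith (Real.toNNReal H) θ (v j t) := by
  refine BDSV.holderWith_of_norm_sub_le hH0 fun x y => ?_
  refine (hH.norm_sub_le_holderSum hT ha hM θ.coe_nonneg hθ1 hj ht x y).trans ?_
  exact mul_le_mul_of_nonneg_right (hsum j) (Real.rpow_nonneg dist_nonneg _)

end History

/-! ## The assembly -/

section Assembly

open BDSV in
/-- **De Rosa 2019, Prop. 4.1 (main iterative proposition), one step along a construction
history, in the regime `γ < β` — derived from the three stages**
(De Rosa 2019, §5.3, p. 14: "Then Proposition 4.1 is just a consequence of estimates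
(5.19)–(5.21), Proposition 5.1 and Proposition 5.5 (again, a detailed proof can be found in
[BDLSV2017])", i.e. BDSV §2.6 "Proof of Proposition 2.1"; plus §4.2 for the Hölder bound of the
input along the history). As printed (§4.1, Prop. 4.1): "There exists a universal constant `M`
with the following property. Let `0 < β < 1/3`, `0 < γ < 1/3` and (4.11)
`1 < b < min{(1-β)/(2β), 4/3}`. Then there exists an `α₀` depending only on `β` and `b`, such that
for any `0 < α < α₀` there exists an `a₀` depending on `β`, `b`, `α` and `M`, such that for any
`a ≥ a₀` the following holds: given a strictly positive function `e : [0,T] → ℝ⁺` satisfying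
(4.2), and a triple `(v_q, p_q, R̊_q)` solving (NSR)–(4.4) and satisfying the estimates
(4.7)–(4.10), then there exists a solution `(v_{q+1}, p_{q+1}, R̊_{q+1})` to (NSR)–(4.4) satisfying
(4.7)–(4.10) with `q` replaced by `q+1`. Moreover, we have (4.12)
`‖v_{q+1} - v_q‖₀ + λ_{q+1}^{-1}‖v_{q+1} - v_q‖₁ ≤ M δ_{q+1}^{1/2}`. Furthermore, `v_{q+1}(·,0)`
depends only on `e(0)` and `v_q(·,0)`." Here: the printed quantifier prefix with the exponents
in the regime `0 < γ < β < 1/3` covered by the printed proof (see `DeRosaStep.lean`, module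
docstring), then every viscosity `ν ∈ (0,1)` and every `T > 0`, and the one-step statement
`DeRosa.StepAt` (input = the last stage of a construction history from zero, `DeRosa.IsHistory`;
output solving (NSR), obeying (4.7)–(4.10) at `q+1` and (4.12), time-zero slice
`Ψ_q (e 0) (v_q(·,0))`), DERIVED from the three stages (mollification `DeRosa.mollificationStage`,
gluing `DeRosa.gluingStage`, perturbation `DeRosa.perturbationStage`, combined into the seven
stage estimates by `DeRosa.stageEstimates_of_threeStages`): the exponent `θ = (γ+β)/2` and the
Hölder constant of `IsHistory.holderWith` / `DeRosa.exists_holderSum_le` (uniform in `a ≥ 2`)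
feed the Hölder hypothesis of the stages; (4.12) and (4.8), (4.9) at `q+1` follow by the triangle
inequality and (4.7), (4.10) at `q+1` from (5.20), (5.21) by the parameter inequalities of
`BDSV.exists_mainThreshold` (`α` small, `a` large); the time-zero clause is that of the stages.
(D-0026: neither this one-step form of Prop. 4.1 nor the seven stage estimates is a separate
named fact of the tree; the named facts are the three stages below them and
`DeRosa.iterativeSchemeLT` above them.)
[cite: Derosa2018, §4.1 Prop. 4.1; §5.3 (p. 14); §4.2] -/
theorem stepAt_of_threeStages (h1 : DeRosa.mollificationStage) (h2 : DeRosa.gluingStage)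
    (h3 : DeRosa.perturbationStage) :
    ∃ M : ℝ, 0 < M ∧
      ∀ β : ℝ, 0 < β → β < 1 / 3 → ∀ γ : ℝ, 0 < γ → γ < β →
        ∀ b : ℝ, 1 < b → b < (1 - β) / (2 * β) → b < 4 / 3 →
          ∃ α₀ : ℝ, 0 < α₀ ∧ ∀ α : ℝ, 0 < α → α < α₀ →
            ∃ a₀ : ℝ, 1 < a₀ ∧ ∀ a : ℝ, a₀ ≤ a →
              ∀ ν : ℝ, 0 < ν → ν < 1 → ∀ T : ℝ, 0 < T → StepAt M β γ α a b ν T := by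
  obtain ⟨M, hM, hstage⟩ := stageEstimates_of_threeStages h1 h2 h3
  refine ⟨M, hM, fun β hβ hβ3 γ hγ hγβ b hb hbβ hb43 => ?_⟩
  -- the intermediate Hölder exponent `θ = (γ+β)/2 ∈ (γ, β)`
  set θr : ℝ := (γ + β) / 2 with hθr
  have hθr0 : 0 < θr := by rw [hθr]; linarith
  have hγθ : γ < θr := by rw [hθr]; linarith
  have hθβ : θr < β := by rw [hθr]; linarith
  have hθ1 : θr ≤ 1 := by linarith
  have hcoe : ((Real.toNNReal θr : ℝ≥0) : ℝ) = θr := Real.coe_toNNReal θr hθr0.le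
  obtain ⟨α₀, hα₀, hα⟩ := hstage β hβ hβ3 γ hγ hγβ b hb hbβ hb43 (Real.toNNReal θr)
    (by rw [hcoe]; exact hγθ) (by rw [hcoe]; exact hθβ)
  -- the exponent `E₀ = (2βb - (1-β))(b-1)` of BDSV (2.26) at `α = 0` is negative by (4.11)
  have hβ1 : β < 1 := by linarith
  have h2β : 0 < 2 * β := by linarith
  have h2βb : 2 * β * b < 1 - β := by
    have := (lt_div_iff₀ h2β).1 hbβ
    linarith
  have hb0 : (0 : ℝ) < b := by linarith
  have hE₀neg : (2 * β * b - (1 - β)) * (b - 1) < 0 :=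
    mul_neg_of_neg_of_pos (by linarith) (by linarith)
  -- the threshold `α₀` of Prop. 4.1
  refine ⟨min α₀ (-((2 * β * b - (1 - β)) * (b - 1)) / (8 * b)),
    lt_min hα₀ (div_pos (by linarith) (by linarith)), fun α hαpos hαlt => ?_⟩
  have hαlt₀ : α < α₀ := lt_of_lt_of_le hαlt (min_le_left _ _)
  have hα8 : 8 * α * b < -((2 * β * b - (1 - β)) * (b - 1)) := by
    have h1 : α < -((2 * β * b - (1 - β)) * (b - 1)) / (8 * b) :=
      lt_of_lt_of_le hαlt (min_le_right _ _)
    have h8b : (0 : ℝ) < 8 * b := by linarith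
    have := (lt_div_iff₀ h8b).1 h1
    linarith
  -- the Hölder constant of the history bound, uniform in `a ≥ 2` (§4.2)
  have hKc : 0 ≤ (2 * M) ^ (1 - θr) * (6 * M) ^ θr :=
    mul_nonneg (Real.rpow_nonneg (by linarith) _) (Real.rpow_nonneg (by linarith) _)
  obtain ⟨H, hH0, hHsum⟩ := exists_holderSum_le (aS := 2) (b := b) (g := β - θr)
    (Kc := (2 * M) ^ (1 - θr) * (6 * M) ^ θr) one_lt_two hb (by linarith) hKc
  obtain ⟨C, a₀, ha₀, hstep⟩ := hα α hαpos hαlt₀ (Real.toNNReal H)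
  -- the constant `C' = max C 1` and the threshold `a₀` of Prop. 4.1
  set C' : ℝ := max C 1 with hC'
  have hCC' : C ≤ C' := le_max_left _ _
  have hC'0 : 0 ≤ C' := le_trans zero_le_one (le_max_right _ _)
  obtain ⟨a₁, ha₁, hthr⟩ := exists_mainThreshold hβ hβ1 hb hαpos hα8 hM C'
  refine ⟨max (max a₀ a₁) 2, lt_max_of_lt_left (lt_max_of_lt_left ha₀),
    fun a ha ν hν hν1 T hT q => ?_⟩
  have ha0' : a₀ ≤ a := le_of_max_le_left (le_of_max_le_left ha)
  have ha1' : a₁ ≤ a := le_of_max_le_right (le_of_max_le_left ha)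
  have ha2 : (2 : ℝ) ≤ a := le_of_max_le_right ha
  have ha1 : (1 : ℝ) ≤ a := by linarith
  -- the time-zero trace of the stages at stage `q`
  obtain ⟨Ψ, hΨ⟩ := hstep a ha0' ν hν hν1 T hT q
  refine ⟨Ψ, fun e he v p R hHist => ?_⟩
  have hT0 : (0 : ℝ) ≤ T := hT.le
  -- the Hölder bound of the input along the history (§4.2)
  have hHol : ∀ t ∈ Icc 0 T, HolderWith (Real.toNNReal H) (Real.toNNReal θr) (v q t) := by
    intro t ht
    refine hHist.holderWith hT0 ha1 hM.le (by rw [hcoe]; exact hθ1) hH0 (fun j => ?_) le_rfl ht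
    rw [hcoe]
    exact hHsum a ha2 j
  -- the input triple: the last stage of the history
  have hER : Torus.IsFracNSReynoldsOn (Icc 0 T) γ ν (v q) (p q) (R q) :=
    hHist.isFracNSReynoldsOn q le_rfl
  have hIE : InductiveEstimates M β α a b T e q (v q) (R q) := hHist.inductiveEstimates q le_rfl
  obtain ⟨hU1, hU2, hU3, hU4, hU5, hU6⟩ := hthr a ha1' q
  obtain ⟨vℓ, vbar, v', p', R', hvℓs, hvbars, hER', h12, ⟨bℓ₀, bℓ₁, hℓsup, hℓder, hℓle⟩, h18,
    ⟨bb₀, bb₁, hbsup, hbder, hble⟩, ⟨B₀', B₁', hsup', hder', hle'⟩, h24, h62, h0⟩ :=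
    hΨ e he (v q) (p q) (R q) hER hIE hHol
  -- positivity of the parameters
  have hf0 := freq_pos (b := b) ha1 q
  have hf1 := freq_pos (b := b) ha1 (q + 1)
  have hf1' : (1 : ℝ) ≤ freq a b (q + 1) := one_le_freq ha1 (q + 1)
  have hi1 : (0 : ℝ) ≤ (freq a b (q + 1))⁻¹ := inv_nonneg.2 hf1.le
  have hi1' : (freq a b (q + 1))⁻¹ ≤ 1 := inv_le_one_of_one_le₀ hf1'
  have hs0 : 0 ≤ Real.sqrt (amp β a b q) := Real.sqrt_nonneg _
  have hs1 : 0 ≤ Real.sqrt (amp β a b (q + 1)) := Real.sqrt_nonneg _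
  have hA2 : 0 < amp β a b (q + 1 + 1) := amp_pos ha1 _
  have hℓ0 : 0 < mollScale β α a b q := mollScale_pos ha1 q
  have hℓα : mollScale β α a b q ^ α ≤ freq a b q ^ (-α) :=
    mollScale_rpow_le ha1 hb.le hβ.le hαpos.le q
  -- smoothness of the slices of `v_q` and `v_{q+1}`
  have hvs : ∀ t ∈ Icc 0 T, FunctionSpaces.Torus.IsSmooth (v q t) := fun t ht =>
    hER.smooth_velocity.isSmooth_slice ht
  have hv's : ∀ t ∈ Icc 0 T, FunctionSpaces.Torus.IsSmooth (v' t) := fun t ht =>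
    hER'.smooth_velocity.isSmooth_slice ht
  -- (4.8) at stage `q`
  obtain ⟨Bq₀, Bq₁, hqsup, hqder, hqle⟩ := hIE.velocity_C1_le
  -- nonnegativity of the bounds
  have hBq₀ : 0 ≤ Bq₀ := hqsup.nonneg hT0
  have hBq₁ : 0 ≤ Bq₁ := hqder.nonneg hT0
  have hbℓ₀ : 0 ≤ bℓ₀ := hℓsup.nonneg hT0
  have hbℓ₁ : 0 ≤ bℓ₁ := hℓder.nonneg hT0
  have hbb₀ : 0 ≤ bb₀ := hbsup.nonneg hT0
  have hbb₁ : 0 ≤ bb₁ := hbder.nonneg hT0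
  have hB₀' : 0 ≤ B₀' := hsup'.nonneg hT0
  have hB₁' : 0 ≤ B₁' := hder'.nonneg hT0
  -- replace the constant `C` by `C' = max C 1 ≥ C`
  have hr0 : 0 ≤ freq a b q ^ (-α) := Real.rpow_nonneg hf0.le _
  have hrℓ : 0 ≤ mollScale β α a b q ^ α := Real.rpow_nonneg hℓ0.le _
  have hr1 : 0 ≤ freq a b (q + 1) ^ (-1 + 4 * α) := Real.rpow_nonneg hf1.le _
  have hr2 : 0 ≤ freq a b q ^ (1 + 2 * α) := Real.rpow_nonneg hf0.le _
  have h12' : SupLE T (fun t x => vℓ t x - v q t x)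
      (C' * (Real.sqrt (amp β a b (q + 1)) * freq a b q ^ (-α))) :=
    h12.mono (mul_le_mul_of_nonneg_right hCC' (mul_nonneg hs1 hr0))
  have h18' : SupLE T (fun t x => vbar t x - vℓ t x)
      (C' * (Real.sqrt (amp β a b (q + 1)) * mollScale β α a b q ^ α)) :=
    h18.mono (mul_le_mul_of_nonneg_right hCC' (mul_nonneg hs1 hrℓ))
  have hℓle' : bℓ₀ + bℓ₁ ≤ C' * (Real.sqrt (amp β a b q) * freq a b q) :=
    hℓle.trans (mul_le_mul_of_nonneg_right hCC' (mul_nonneg hs0 hf0.le))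
  have hble' : bb₀ + bb₁ ≤ C' * (Real.sqrt (amp β a b q) * freq a b q) :=
    hble.trans (mul_le_mul_of_nonneg_right hCC' (mul_nonneg hs0 hf0.le))
  have h24' : SupLE T R' (C' * (Real.sqrt (amp β a b (q + 1)) * Real.sqrt (amp β a b q) *
      freq a b q * freq a b (q + 1) ^ (-1 + 4 * α))) :=
    h24.mono (mul_le_mul_of_nonneg_right hCC'
      (mul_nonneg (mul_nonneg (mul_nonneg hs1 hs0) hf0.le) hr1))
  have h62' : ∀ t ∈ Icc 0 T, |e t - (∫ x, ‖v' t x‖ ^ 2) - amp β a b (q + 1 + 1) / 2| ≤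
      C' * (Real.sqrt (amp β a b q) * Real.sqrt (amp β a b (q + 1)) *
        freq a b q ^ (1 + 2 * α) * (freq a b (q + 1))⁻¹) := fun t ht =>
    (h62 t ht).trans (mul_le_mul_of_nonneg_right hCC'
      (mul_nonneg (mul_nonneg (mul_nonneg hs0 hs1) hr2) hi1))
  -- the two small sup bounds (5.13), (5.5): `S₁ ≤ S₂ ≤ (M/16) δ_{q+1}^{1/2}`
  set S₁ : ℝ := C' * (Real.sqrt (amp β a b (q + 1)) * mollScale β α a b q ^ α) with hS₁
  set S₂ : ℝ := C' * (Real.sqrt (amp β a b (q + 1)) * freq a b q ^ (-α)) with hS₂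
  have hS₁0 : 0 ≤ S₁ := mul_nonneg hC'0 (mul_nonneg hs1 hrℓ)
  have hS₁₂ : S₁ ≤ S₂ := mul_le_mul_of_nonneg_left (mul_le_mul_of_nonneg_left hℓα hs1) hC'0
  have hS₂le : S₂ ≤ M / 16 * Real.sqrt (amp β a b (q + 1)) := by
    have := mul_le_mul_of_nonneg_left hU1 hs1
    calc S₂ = Real.sqrt (amp β a b (q + 1)) * (C' * freq a b q ^ (-α)) := by rw [hS₂]; ring
      _ ≤ Real.sqrt (amp β a b (q + 1)) * (M / 16) := this
      _ = M / 16 * Real.sqrt (amp β a b (q + 1)) := mul_comm _ _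
  -- scalar consequences of (4.8), (5.6), (5.15)
  have hBq₁le : Bq₁ ≤ M * Real.sqrt (amp β a b q) * freq a b q := by linarith
  have hbℓ₁le : bℓ₁ ≤ C' * (Real.sqrt (amp β a b q) * freq a b q) := by linarith
  have hbb₁le : bb₁ ≤ C' * (Real.sqrt (amp β a b q) * freq a b q) := by linarith
  have hMsf : 0 ≤ M * (Real.sqrt (amp β a b q) * freq a b q) :=
    mul_nonneg hM.le (mul_nonneg hs0 hf0.le)
  have hsum : bb₁ + bℓ₁ + bℓ₁ + Bq₁ ≤
      (3 * C' + 2 * M) * (Real.sqrt (amp β a b q) * freq a b q) := by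
    linarith
  -- the tail `λ_{q+1}^{-1} (3C'+2M) δ_q^{1/2} λ_q ≤ (M/4) δ_{q+1}^{1/2}`
  have htail : (freq a b (q + 1))⁻¹ * (bb₁ + bℓ₁ + bℓ₁ + Bq₁) ≤
      M / 4 * Real.sqrt (amp β a b (q + 1)) := by
    have hd1 := mul_le_mul_of_nonneg_left hsum hi1
    have hd2 := mul_le_mul_of_nonneg_left hU2 hi1
    have hd3 : (freq a b (q + 1))⁻¹ * (M / 4 * (Real.sqrt (amp β a b (q + 1)) * freq a b (q + 1))) =
        M / 4 * Real.sqrt (amp β a b (q + 1)) := by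
      rw [inv_mul_eq_div, div_eq_iff hf1.ne']
      ring
    linarith
  -- the increment `w = v_{q+1} - v_q` and its bounds `B₀ = ‖w‖₀`, `B₁ = [w]₁`
  have hS₂0 : 0 ≤ S₂ := hS₁0.trans hS₁₂
  set B₀ : ℝ := B₀' + S₁ + S₂ with hB₀
  set B₁ : ℝ := B₁' + (bb₁ + bℓ₁) + (bℓ₁ + Bq₁) with hB₁
  have hB₀0 : 0 ≤ B₀ := by rw [hB₀]; linarith
  have hB₁0 : 0 ≤ B₁ := by rw [hB₁]; linarith
  have hwsup : SupLE T (fun t x => v' t x - v q t x) B₀ := by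
    intro t ht x
    show ‖v' t x - v q t x‖ ≤ B₀
    have e1 : v' t x - v q t x =
        (v' t x - vbar t x) + (vbar t x - vℓ t x) + (vℓ t x - v q t x) := by
      abel
    rw [e1]
    exact (norm_add₃_le).trans (add_le_add (add_le_add (hsup' t ht x) (h18' t ht x)) (h12' t ht x))
  have hwder : DerivSupLE T (fun t x => v' t x - v q t x) B₁ := by
    intro i t ht x
    show ‖FunctionSpaces.Torus.partialDeriv i (fun y => v' t y - v q t y) x‖ ≤ B₁
    have k1 : ‖FunctionSpaces.Torus.partialDeriv i (fun y => v' t y - vbar t y) x‖ ≤ B₁' :=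
      hder' i t ht x
    have k2 := hbder i t ht x
    have k3 := hℓder i t ht x
    have k4 := hqder i t ht x
    rw [partialDeriv_sub_of_isSmooth (hv's t ht) (hvbars t ht)] at k1
    rw [partialDeriv_sub_of_isSmooth (hv's t ht) (hvs t ht)]
    have e1 : FunctionSpaces.Torus.partialDeriv i (v' t) x -
          FunctionSpaces.Torus.partialDeriv i (v q t) x =
        (FunctionSpaces.Torus.partialDeriv i (v' t) x -
            FunctionSpaces.Torus.partialDeriv i (vbar t) x) +
          (FunctionSpaces.Torus.partialDeriv i (vbar t) x -
            FunctionSpaces.Torus.partialDeriv i (vℓ t) x) +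
          (FunctionSpaces.Torus.partialDeriv i (vℓ t) x -
            FunctionSpaces.Torus.partialDeriv i (v q t) x) := by
      abel
    rw [e1]
    refine (norm_add₃_le).trans ?_
    have i2 := (norm_sub_le (FunctionSpaces.Torus.partialDeriv i (vbar t) x)
      (FunctionSpaces.Torus.partialDeriv i (vℓ t) x)).trans (add_le_add k2 k3)
    have i3 := (norm_sub_le (FunctionSpaces.Torus.partialDeriv i (vℓ t) x)
      (FunctionSpaces.Torus.partialDeriv i (v q t) x)).trans (add_le_add k3 k4)
    linarith
  -- (4.12): `B₀ + λ_{q+1}^{-1} (B₀ + B₁) ≤ M δ_{q+1}^{1/2}`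
  have hmain : B₀ + (freq a b (q + 1))⁻¹ * (B₀ + B₁) ≤ M * Real.sqrt (amp β a b (q + 1)) := by
    have hiS : (freq a b (q + 1))⁻¹ * (S₁ + S₂) ≤ S₁ + S₂ := by
      have hS0 : 0 ≤ S₁ + S₂ := by linarith
      calc (freq a b (q + 1))⁻¹ * (S₁ + S₂) ≤ 1 * (S₁ + S₂) :=
            mul_le_mul_of_nonneg_right hi1' hS0
        _ = S₁ + S₂ := one_mul _
    have e1 : B₀ + (freq a b (q + 1))⁻¹ * (B₀ + B₁) =
        (B₀' + (freq a b (q + 1))⁻¹ * (B₀' + B₁')) + (S₁ + S₂) +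
          (freq a b (q + 1))⁻¹ * (S₁ + S₂) +
          (freq a b (q + 1))⁻¹ * (bb₁ + bℓ₁ + bℓ₁ + Bq₁) := by
      rw [hB₀, hB₁]
      ring
    rw [e1]
    linarith
  have hVI : VelocityIncrementBound M β a b T q (fun t x => v' t x - v q t x) :=
    ⟨B₀, B₁, hwsup, hwder, hmain⟩
  -- consequences of (4.12): `‖w‖₀ ≤ M δ_{q+1}^{1/2}` and `B₀' + B₁' ≤ λ_{q+1} (M/2) δ_{q+1}^{1/2}`
  have hB₀le : B₀ ≤ M * Real.sqrt (amp β a b (q + 1)) := by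
    have : 0 ≤ (freq a b (q + 1))⁻¹ * (B₀ + B₁) := mul_nonneg hi1 (add_nonneg hB₀0 hB₁0)
    linarith
  have hB'sum : B₀' + B₁' ≤ freq a b (q + 1) * (M / 2 * Real.sqrt (amp β a b (q + 1))) := by
    have he1 : (freq a b (q + 1))⁻¹ * (B₀' + B₁') ≤ M / 2 * Real.sqrt (amp β a b (q + 1)) := by
      linarith
    calc B₀' + B₁' = freq a b (q + 1) * ((freq a b (q + 1))⁻¹ * (B₀' + B₁')) := by
          rw [← mul_assoc, mul_inv_cancel₀ hf1.ne', one_mul]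
      _ ≤ freq a b (q + 1) * (M / 2 * Real.sqrt (amp β a b (q + 1))) :=
          mul_le_mul_of_nonneg_left he1 hf1.le
  -- the new triple satisfies the inductive estimates (4.7)–(4.10) at stage `q+1`
  have hIE' : InductiveEstimates M β α a b T e (q + 1) v' R' := by
    refine ⟨h24'.mono hU4, ⟨Bq₀ + B₀, Bq₁ + B₁, ?_, ?_, ?_⟩, ?_, ?_, ?_⟩
    · -- `‖v_{q+1}‖₀ ≤ ‖v_q‖₀ + ‖w‖₀`
      intro t ht x
      have e1 : v' t x = v q t x + (v' t x - v q t x) := by abel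
      rw [e1]
      exact (norm_add_le _ _).trans (add_le_add (hqsup t ht x) (hwsup t ht x))
    · -- `[v_{q+1}]₁ ≤ [v_q]₁ + [w]₁`
      intro i t ht x
      have k1 := hqder i t ht x
      have k2 : ‖FunctionSpaces.Torus.partialDeriv i (fun y => v' t y - v q t y) x‖ ≤ B₁ :=
        hwder i t ht x
      rw [partialDeriv_sub_of_isSmooth (hv's t ht) (hvs t ht)] at k2
      have e1 : FunctionSpaces.Torus.partialDeriv i (v' t) x =
          FunctionSpaces.Torus.partialDeriv i (v q t) x +
            (FunctionSpaces.Torus.partialDeriv i (v' t) x -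
              FunctionSpaces.Torus.partialDeriv i (v q t) x) := by
        abel
      rw [e1]
      exact (norm_add_le _ _).trans (add_le_add k1 k2)
    · -- (4.8) at `q+1`: `‖v_{q+1}‖₁ ≤ M δ_{q+1}^{1/2} λ_{q+1}` for `a` large
      have hsf : Real.sqrt (amp β a b (q + 1)) ≤ Real.sqrt (amp β a b (q + 1)) * freq a b (q + 1) :=
        le_mul_of_one_le_right hs1 hf1'
      have hsf' : M / 8 * Real.sqrt (amp β a b (q + 1)) ≤
          M / 8 * (Real.sqrt (amp β a b (q + 1)) * freq a b (q + 1)) :=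
        mul_le_mul_of_nonneg_left hsf (by linarith)
      have hS8 : S₁ + S₂ ≤ M / 8 * (Real.sqrt (amp β a b (q + 1)) * freq a b (q + 1)) := by
        linarith
      have hlow : Bq₀ + Bq₁ + (bb₁ + bℓ₁ + bℓ₁ + Bq₁) ≤
          (3 * C' + 2 * M) * (Real.sqrt (amp β a b q) * freq a b q) := by
        linarith
      have e1 : Bq₀ + B₀ + (Bq₁ + B₁) =
          (B₀' + B₁') + (S₁ + S₂) + (Bq₀ + Bq₁ + (bb₁ + bℓ₁ + bℓ₁ + Bq₁)) := by
        rw [hB₀, hB₁]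
        ring
      rw [e1]
      linarith
    · -- (4.9) at `q+1`: `‖v_{q+1}‖₀ ≤ 1 - δ_q^{1/2} + M δ_{q+1}^{1/2} ≤ 1 - δ_{q+1}^{1/2}`
      intro t ht x
      have e1 : v' t x = v q t x + (v' t x - v q t x) := by abel
      rw [e1]
      refine (norm_add_le _ _).trans ?_
      have k1 := hIE.velocity_le t ht x
      have k2 := hwsup t ht x
      linarith
    · -- (4.10) at `q+1`, lower bound, from (5.21)
      intro t ht
      have habs := abs_le.1 (h62' t ht)
      have k1 : amp β a b (q + 1 + 1) * freq a b (q + 1) ^ (-α) ≤ amp β a b (q + 1 + 1) * (1 / 4) :=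
        mul_le_mul_of_nonneg_left hU6 hA2.le
      linarith [habs.1]
    · -- (4.10) at `q+1`, upper bound, from (5.21)
      intro t ht
      have habs := abs_le.1 (h62' t ht)
      linarith [habs.2, hA2.le]
  exact ⟨v', p', R', hER', hIE', hVI, h0⟩

/-- **The three stages imply Prop. 4.1 run from zero in the regime `γ < β`**:
`mollificationStage → gluingStage → perturbationStage → DeRosa.iterativeSchemeLT`, composing
`stepAt_of_threeStages` (Prop. 4.1, one step along every history) with the iteration along
histories `DeRosa.schemeAt_of_stepAt` (§4.2, "we apply Proposition 4.1 iteratively with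
`(v₀, R₀, p₀) = (0,0,0)`") under the common quantifier prefix.
[cite: Derosa2018, §4.2; §5.3 (p. 14)] -/
theorem iterativeSchemeLT_of_threeStages (h1 : DeRosa.mollificationStage)
    (h2 : DeRosa.gluingStage) (h3 : DeRosa.perturbationStage) : iterativeSchemeLT := by
  obtain ⟨M, hM, h⟩ := stepAt_of_threeStages h1 h2 h3
  refine ⟨M, hM, fun β hβ hβ3 γ hγ hγβ b hb hbβ hb43 => ?_⟩
  obtain ⟨α₀, hα₀, h⟩ := h β hβ hβ3 γ hγ hγβ b hb hbβ hb43
  refine ⟨α₀, hα₀, fun α hα hαα₀ => ?_⟩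
  obtain ⟨a₀, ha₀, h⟩ := h α hα hαα₀
  exact ⟨a₀, ha₀, fun a ha ν hν hν1 T hT => schemeAt_of_stepAt (h a ha ν hν hν1 T hT)⟩

/-- **Prop. 4.1 run from zero (`γ < β`) from the gluing and perturbation stages alone**, the
mollification stage (Prop. 5.1) being discharged (`DeRosa.mollificationStage_holds`,
`DeRosaMollificationProofs.lean`): the trust base of `DeRosa.iterativeSchemeLT` is
`DeRosa.gluingStage` (§5.2) and `DeRosa.perturbationStage` (§§5.3–5.5).
[cite: Derosa2018, §4.2; §5 (Prop. 5.1, §5.2, §§5.3–5.5)] -/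
theorem iterativeSchemeLT_of_gluing_of_perturbation (h2 : DeRosa.gluingStage)
    (h3 : DeRosa.perturbationStage) : iterativeSchemeLT :=
  iterativeSchemeLT_of_threeStages mollificationStage_holds h2 h3

end Assembly

end DeRosa

end Literature.Analysis.FluidPDE
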